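import Mathlib
import HarnessLib
import Summits.Ventures.LatticeQCDFlow.Scaling.AbelianHolonomyDetermination

/-!
# LatticeQCDFlow / Scaling — integer cycles of `(ℤ/L)^d` in normal form: winding lines plus covered
# boundaries; for an abelian field, the covered plaquettes and the `d` Polyakov lines determine the
# holonomy of EVERY closed lattice loop

HONEST FRAMING: exact (Metropolis-corrected) sampling algorithms for lattice gauge theory;
figures of merit are autocorrelation/cost numbers at stated couplings and volumes; no
continuum-physics claim.

Venture `LatticeQCDFlow` (cell pub-lqcd), topic `Scaling`, FANOUT row 30 (lean-1, GEN-27) — OUR WORK on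
THEORY-2.md §4 row C5 (gen25 Q2, completed to all loops).  `Scaling/TorusRankedIntegerSpan`: for a FULL
ranked structure `B` of `(ℤ/L)^d` (`#B = (d−1)(L^d − 1)`) the integer chains with zero divergence AND zero
winding are exactly the integer combinations of the covered boundaries `σ∂p`, `p ∈ B`.  Dropping the winding
condition costs exactly the `d` straight lines:

* §1 the STRAIGHT LINE `z_n = Σ_{c ∈ ℤ/L} 𝟙_{(c·e_n, n)}` over `ℤ` has zero divergence (**`intDivergence_line`**)
  and winding vector `𝟙_n` (**`intWinding_line`**) — the integer versions of `TorusRankedHomologyBound` §2;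
* §2 **`exists_eq_lines_add_sum_smul_signedBoundary`** — NORMAL FORM: every integer chain `v` with zero
  divergence is `v = Σ_n W_n(v)·z_n + Σ_{p∈B} c_p σ∂p`, `W(v)` its winding vector, for every full ranked `B`;
  and **`lines_add_sum_smul_signedBoundary_unique`** — the coefficients `(W, c)` are unique (the winding
  functionals read off `W`; the top-link pivots read off `c`).  In words: the first homology of the cubical
  torus `(ℤ/L)^d` with INTEGER coefficients is free of rank `d` on the straight lines, and a full ranked
  structure is a `ℤ`-basis of the boundaries;
* §3 for a COMMUTATIVE gauge group: **`exists_loopHolonomy_eq`** — for every closed integer chain `v`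
  (zero divergence: every closed lattice loop, contractible or not) there are integers `c_p`, independent of
  the configuration, with `U^v = ∏_n P_n(U)^{W_n(v)} · ∏_{p∈B} U_p^{c_p}`, where `P_n(U) = U^{z_n}` is the
  POLYAKOV LINE in direction `n`; hence **`loopHolonomy_eq_of_covered_eq_of_lines_eq`** — two abelian
  configurations with the same covered holonomies and the same `d` Polyakov lines have the same holonomy
  around EVERY closed loop: along a full ranked structure, the covered plaquettes and the `d` Polyakov lines
  carry the entire loop content of an abelian lattice gauge field.

No `def`, no `sorry`, nothing cited as a fact beyond the tree.
-/

namespace Summit.Ventures.LatticeQCDFlow.Theory2.Autoregressive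

open Finset
open Literature.MathematicalPhysics.QuantumFieldTheory

variable {d L : ℕ} [NeZero L]

/-! ## §1 The straight lines over `ℤ` -/

/-- **The straight line `z_n` has zero divergence** (it is invariant under the shift by `e_n`, so the
endpoint indicators telescope around the cycle `ℤ/L`). [ours] -/
theorem intDivergence_line (n : Fin d) :
    (fun y : Site d L => ∑ i : Fin d,
      ((∑ c : ZMod L, (Pi.single ((Pi.single n c : Site d L), n) 1 : Edge d L → ℤ)) (y, i) -
        (∑ c : ZMod L, (Pi.single ((Pi.single n c : Site d L), n) 1 : Edge d L → ℤ)) (y - Pi.single i 1, i))) = 0 := by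
  classical
  have hlin := (intDivergence_isLinear (d := d) (L := L))
  have happ : ∀ f : Edge d L → ℤ, (hlin.mk') f =
      fun y : Site d L => ∑ i : Fin d, (f (y, i) - f (y - Pi.single i 1, i)) := fun f => rfl
  rw [← happ, map_sum]
  simp only [happ, intDivergence_single]
  have hshift : ∀ c : ZMod L, Site.shift (Pi.single n c : Site d L) n = Pi.single n (c + 1) := by
    intro c; simp only [Site.shift, ← Pi.single_add]
  simp only [hshift, Finset.sum_sub_distrib]
  have hre : ∑ c : ZMod L, (Pi.single (Pi.single n (c + 1) : Site d L) 1 : Site d L → ℤ) =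
      ∑ c : ZMod L, (Pi.single (Pi.single n c : Site d L) 1 : Site d L → ℤ) :=
    Fintype.sum_equiv (Equiv.addRight 1) _ _ (fun c => rfl)
  rw [hre, sub_self]

/-- **The straight line `z_n` has winding vector `𝟙_n`**: it crosses the hyperplane `{x_n = 0}` exactly once and
has no links in the other directions. [ours] -/
theorem intWinding_line (n : Fin d) :
    (fun m : Fin d => ∑ x ∈ (Finset.univ.filter fun x : Site d L => x m = 0), (∑ c : ZMod L, (Pi.single ((Pi.single n c : Site d L), n) 1 : Edge d L → ℤ)) (x, m)) =
      (Pi.single n 1 : Fin d → ℤ) := by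
  classical
  ext m
  simp only [Finset.sum_apply, Finset.sum_comm (s := Finset.univ.filter fun x : Site d L => x m = 0),
    intWinding_single, Pi.single_eq_same]
  by_cases hm : m = n
  · subst hm
    simp [Finset.sum_ite_eq']
  · simp [hm]

/-! ## §2 Normal form of integer cycles -/

/-- **NORMAL FORM OF INTEGER CYCLES.**  `L ≥ 2`; `(B, t, rank)` ranked and full (`#B = (d−1)(L^d − 1)`).
Every integer chain `v` with zero divergence is `Σ_n W_n·z_n + Σ_{p∈B} c_p σ∂p` with `W` ITS WINDING VECTOR
and integers `c_p` (subtract the lines, then `TorusRankedIntegerSpan.exists_eq_sum_smul_signedBoundary`).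
[ours] -/
theorem exists_eq_lines_add_sum_smul_signedBoundary (hL : 2 ≤ L) (B : Finset (Plaquette d L))
    (t : Plaquette d L → Edge d L)
    (ht : ∀ p ∈ B, t p ∈ ({(p.1, p.2.1.1), (p.1.shift p.2.1.1, p.2.1.2),
        (p.1.shift p.2.1.2, p.2.1.1), (p.1, p.2.1.2)} : Finset (Edge d L)))
    (rank : Plaquette d L → ℕ)
    (hrank : ∀ p ∈ B, ∀ p' ∈ B, p ≠ p' → t p ∈ ({(p'.1, p'.2.1.1), (p'.1.shift p'.2.1.1, p'.2.1.2),
        (p'.1.shift p'.2.1.2, p'.2.1.1), (p'.1, p'.2.1.2)} : Finset (Edge d L)) → rank p < rank p')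
    (hcard : B.card = (d - 1) * (L ^ d - 1)) (v : Edge d L → ℤ)
    (hdiv : (fun y : Site d L => ∑ i : Fin d, (v (y, i) - v (y - Pi.single i 1, i))) = 0) :
    ∃ c : Plaquette d L → ℤ, v =
      ∑ n : Fin d, (∑ x ∈ (Finset.univ.filter fun x : Site d L => x n = 0), v (x, n)) •
          (∑ c : ZMod L, (Pi.single ((Pi.single n c : Site d L), n) 1 : Edge d L → ℤ)) +
        ∑ p ∈ B, c p • (Pi.single (p.1, p.2.1.1) 1 + Pi.single (p.1.shift p.2.1.1, p.2.1.2) 1 -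
        Pi.single (p.1.shift p.2.1.2, p.2.1.1) 1 - Pi.single (p.1, p.2.1.2) 1 : Edge d L → ℤ) := by
  classical
  set v' : Edge d L → ℤ := v - ∑ n : Fin d, (∑ x ∈ (Finset.univ.filter fun x : Site d L => x n = 0), v (x, n)) •
    (∑ c : ZMod L, (Pi.single ((Pi.single n c : Site d L), n) 1 : Edge d L → ℤ)) with hv'
  have hD := (intDivergence_isLinear (d := d) (L := L))
  have hWl := (intWinding_isLinear (d := d) (L := L))
  have hDapp : ∀ f : Edge d L → ℤ, (hD.mk') f =
      fun y : Site d L => ∑ i : Fin d, (f (y, i) - f (y - Pi.single i 1, i)) := fun f => rfl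
  have hWapp : ∀ f : Edge d L → ℤ, (hWl.mk') f = (fun m : Fin d => ∑ x ∈ (Finset.univ.filter fun x : Site d L => x m = 0), f (x, m)) := fun f => rfl
  have hdiv' : (fun y : Site d L => ∑ i : Fin d, (v' (y, i) - v' (y - Pi.single i 1, i))) = 0 := by
    have h1 : (hD.mk') v' = (hD.mk') v - ∑ n : Fin d,
        (∑ x ∈ (Finset.univ.filter fun x : Site d L => x n = 0), v (x, n)) • (hD.mk') (∑ c : ZMod L, (Pi.single ((Pi.single n c : Site d L), n) 1 : Edge d L → ℤ)) := by
      rw [hv', map_sub, map_sum]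
      simp only [map_zsmul]
    have h2 : ∀ n : Fin d, (hD.mk') (∑ c : ZMod L, (Pi.single ((Pi.single n c : Site d L), n) 1 : Edge d L → ℤ)) = 0 := fun n => by
      rw [hDapp]; exact intDivergence_line n
    simp only [h2, smul_zero, Finset.sum_const_zero, sub_zero, hDapp] at h1
    rw [h1]; exact hdiv
  have hwind' : (fun m : Fin d => ∑ x ∈ (Finset.univ.filter fun x : Site d L => x m = 0), v' (x, m)) = 0 := by
    have h1 : (hWl.mk') v' = (hWl.mk') v - ∑ n : Fin d,
        (∑ x ∈ (Finset.univ.filter fun x : Site d L => x n = 0), v (x, n)) • (hWl.mk') (∑ c : ZMod L, (Pi.single ((Pi.single n c : Site d L), n) 1 : Edge d L → ℤ)) := by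
      rw [hv', map_sub, map_sum]
      simp only [map_zsmul]
    have h2 : ∀ n : Fin d, (hWl.mk') (∑ c : ZMod L, (Pi.single ((Pi.single n c : Site d L), n) 1 : Edge d L → ℤ)) = (Pi.single n 1 : Fin d → ℤ) := fun n => by
      rw [hWapp]; exact intWinding_line n
    simp only [h2, hWapp] at h1
    rw [h1]
    have h3 : ∑ n : Fin d, (∑ x ∈ (Finset.univ.filter fun x : Site d L => x n = 0), v (x, n)) •
        (Pi.single n 1 : Fin d → ℤ) = (fun m : Fin d => ∑ x ∈ (Finset.univ.filter fun x : Site d L => x m = 0), v (x, m)) := by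
      ext m
      simp [Finset.sum_apply, Pi.single_apply]
    rw [h3, sub_self]
  obtain ⟨c, hc⟩ := exists_eq_sum_smul_signedBoundary hL B t ht rank hrank hcard v' hdiv' hwind'
  refine ⟨c, ?_⟩
  rw [← hc, hv']
  abel

omit [NeZero L] in
/-- **Uniqueness of the normal form**: the winding functionals read off the line coefficients, the top-link
pivots the boundary coefficients. [ours] -/
theorem lines_add_sum_smul_signedBoundary_unique [NeZero L] (hL : 2 ≤ L) (B : Finset (Plaquette d L))
    (t : Plaquette d L → Edge d L)
    (ht : ∀ p ∈ B, t p ∈ ({(p.1, p.2.1.1), (p.1.shift p.2.1.1, p.2.1.2),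
        (p.1.shift p.2.1.2, p.2.1.1), (p.1, p.2.1.2)} : Finset (Edge d L)))
    (rank : Plaquette d L → ℕ)
    (hrank : ∀ p ∈ B, ∀ p' ∈ B, p ≠ p' → t p ∈ ({(p'.1, p'.2.1.1), (p'.1.shift p'.2.1.1, p'.2.1.2),
        (p'.1.shift p'.2.1.2, p'.2.1.1), (p'.1, p'.2.1.2)} : Finset (Edge d L)) → rank p < rank p')
    (a a' : Fin d → ℤ) (c c' : Plaquette d L → ℤ)
    (h : ∑ n : Fin d, a n • (∑ c : ZMod L, (Pi.single ((Pi.single n c : Site d L), n) 1 : Edge d L → ℤ)) +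
        ∑ p ∈ B, c p • (Pi.single (p.1, p.2.1.1) 1 + Pi.single (p.1.shift p.2.1.1, p.2.1.2) 1 -
        Pi.single (p.1.shift p.2.1.2, p.2.1.1) 1 - Pi.single (p.1, p.2.1.2) 1 : Edge d L → ℤ) =
      ∑ n : Fin d, a' n • (∑ c : ZMod L, (Pi.single ((Pi.single n c : Site d L), n) 1 : Edge d L → ℤ)) +
        ∑ p ∈ B, c' p • (Pi.single (p.1, p.2.1.1) 1 + Pi.single (p.1.shift p.2.1.1, p.2.1.2) 1 -
        Pi.single (p.1.shift p.2.1.2, p.2.1.1) 1 - Pi.single (p.1, p.2.1.2) 1 : Edge d L → ℤ)) :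
    a = a' ∧ ∀ p ∈ B, c p = c' p := by
  classical
  have hWl := (intWinding_isLinear (d := d) (L := L))
  have hWapp : ∀ f : Edge d L → ℤ, (hWl.mk') f = (fun m : Fin d => ∑ x ∈ (Finset.univ.filter fun x : Site d L => x m = 0), f (x, m)) := fun f => rfl
  have hline : ∀ n : Fin d, (hWl.mk') (∑ c : ZMod L, (Pi.single ((Pi.single n c : Site d L), n) 1 : Edge d L → ℤ)) = (Pi.single n 1 : Fin d → ℤ) := fun n => by
    rw [hWapp]; exact intWinding_line n
  have hbdry : ∀ p : Plaquette d L, (hWl.mk') (Pi.single (p.1, p.2.1.1) 1 + Pi.single (p.1.shift p.2.1.1, p.2.1.2) 1 -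
        Pi.single (p.1.shift p.2.1.2, p.2.1.1) 1 - Pi.single (p.1, p.2.1.2) 1 : Edge d L → ℤ) = 0 := fun p => by
    rw [hWapp]; funext m; exact intWinding_signedBoundary p m
  have hsum : ∀ b : Fin d → ℤ, ∑ n : Fin d, b n • (Pi.single n 1 : Fin d → ℤ) = b := fun b => by
    ext m; simp [Finset.sum_apply, Pi.single_apply]
  have ha : a = a' := by
    have h1 := congrArg (hWl.mk') h
    simp only [map_add, map_sum, map_zsmul, hline, hbdry, smul_zero, Finset.sum_const_zero, add_zero,
      hsum] at h1
    exact h1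
  refine ⟨ha, ?_⟩
  subst ha
  exact sum_smul_signedBoundary_unique hL B t ht rank hrank c c' (add_left_cancel h)

/-! ## §3 Abelian fields: covered plaquettes and Polyakov lines determine every loop holonomy -/

/-- **LOOP HOLONOMIES FROM COVERED PLAQUETTES AND POLYAKOV LINES.**  `L ≥ 2`; `(B, t, rank)` ranked and full;
`G` commutative.  For every integer chain `v` with zero divergence (every closed lattice loop) there are
integers `c_p`, independent of the configuration, with
`U^v = ∏_n P_n(U)^{W_n(v)} · ∏_{p∈B} U_p^{c_p}`, `P_n(U) = U^{z_n} = ∏_c U(c·e_n, n)` the Polyakov line and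
`W(v)` the winding vector of `v`. [ours] -/
theorem exists_loopHolonomy_eq (hL : 2 ≤ L) (B : Finset (Plaquette d L))
    (t : Plaquette d L → Edge d L)
    (ht : ∀ p ∈ B, t p ∈ ({(p.1, p.2.1.1), (p.1.shift p.2.1.1, p.2.1.2),
        (p.1.shift p.2.1.2, p.2.1.1), (p.1, p.2.1.2)} : Finset (Edge d L)))
    (rank : Plaquette d L → ℕ)
    (hrank : ∀ p ∈ B, ∀ p' ∈ B, p ≠ p' → t p ∈ ({(p'.1, p'.2.1.1), (p'.1.shift p'.2.1.1, p'.2.1.2),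
        (p'.1.shift p'.2.1.2, p'.2.1.1), (p'.1, p'.2.1.2)} : Finset (Edge d L)) → rank p < rank p')
    (hcard : B.card = (d - 1) * (L ^ d - 1)) (v : Edge d L → ℤ)
    (hdiv : (fun y : Site d L => ∑ i : Fin d, (v (y, i) - v (y - Pi.single i 1, i))) = 0) {G : Type*} [CommGroup G] :
    ∃ c : Plaquette d L → ℤ, ∀ U : GaugeConfig d L G,
      ∏ e, U e ^ v e =
        (∏ n : Fin d, (∏ e, U e ^ (∑ c : ZMod L, (Pi.single ((Pi.single n c : Site d L), n) 1 : Edge d L → ℤ)) e) ^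
            (∑ x ∈ (Finset.univ.filter fun x : Site d L => x n = 0), v (x, n))) *
          ∏ p ∈ B, (plaquetteHolonomy U p.1 p.2.1.1 p.2.1.2) ^ c p := by
  obtain ⟨c, hc⟩ := exists_eq_lines_add_sum_smul_signedBoundary hL B t ht rank hrank hcard v hdiv
  refine ⟨c, fun U => ?_⟩
  rw [hc, prod_zpow_add, prod_zpow_sum_smul, prod_zpow_sum_smul, ← hc]
  congr 1
  exact Finset.prod_congr rfl fun p _ => by rw [plaquetteHolonomy_eq_prod_zpow]

/-- **DETERMINATION OF ALL LOOPS.**  `L ≥ 2`; `(B, t, rank)` ranked and full; `G` commutative.  Two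
configurations with the same holonomy around every covered plaquette and the same `d` Polyakov lines have the
same holonomy around EVERY closed lattice loop. [ours] -/
theorem loopHolonomy_eq_of_covered_eq_of_lines_eq (hL : 2 ≤ L) (B : Finset (Plaquette d L))
    (t : Plaquette d L → Edge d L)
    (ht : ∀ p ∈ B, t p ∈ ({(p.1, p.2.1.1), (p.1.shift p.2.1.1, p.2.1.2),
        (p.1.shift p.2.1.2, p.2.1.1), (p.1, p.2.1.2)} : Finset (Edge d L)))
    (rank : Plaquette d L → ℕ)
    (hrank : ∀ p ∈ B, ∀ p' ∈ B, p ≠ p' → t p ∈ ({(p'.1, p'.2.1.1), (p'.1.shift p'.2.1.1, p'.2.1.2),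
        (p'.1.shift p'.2.1.2, p'.2.1.1), (p'.1, p'.2.1.2)} : Finset (Edge d L)) → rank p < rank p')
    (hcard : B.card = (d - 1) * (L ^ d - 1)) {G : Type*} [CommGroup G] (U V : GaugeConfig d L G)
    (hcov : ∀ p ∈ B, plaquetteHolonomy U p.1 p.2.1.1 p.2.1.2 = plaquetteHolonomy V p.1 p.2.1.1 p.2.1.2)
    (hlines : ∀ n : Fin d, ∏ e, U e ^ (∑ c : ZMod L, (Pi.single ((Pi.single n c : Site d L), n) 1 : Edge d L → ℤ)) e =
      ∏ e, V e ^ (∑ c : ZMod L, (Pi.single ((Pi.single n c : Site d L), n) 1 : Edge d L → ℤ)) e)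
    (v : Edge d L → ℤ) (hdiv : (fun y : Site d L => ∑ i : Fin d, (v (y, i) - v (y - Pi.single i 1, i))) = 0) :
    ∏ e, U e ^ v e = ∏ e, V e ^ v e := by
  obtain ⟨c, hc⟩ := exists_loopHolonomy_eq hL B t ht rank hrank hcard v hdiv (G := G)
  rw [hc U, hc V]
  congr 1
  · exact Finset.prod_congr rfl fun n _ => by rw [hlines n]
  · exact Finset.prod_congr rfl fun p hp => by rw [hcov p hp]

end Summit.Ventures.LatticeQCDFlow.Theory2.Autoregressive
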